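import Literature.MathematicalPhysics.QuantumFieldTheory.Balaban1983to89.B2Ineq327ConcreteNeumann
import Literature.MathematicalPhysics.QuantumFieldTheory.Balaban1983to89.B2

/-!
# `Balaban1983to89.B2Eq328ConcretePieces` — [Balaban1982Higgs2] §3.B p. 589–590: **(3.28) «⟨Φ, Δ′(Ã^ε)Φ⟩ =
Σ_{k=0}^{K} ⟨φ_k, Δ^{(k),Lᵏε}(Bᵏ(Λ₅⁽ᵏ⁻¹⁾′∩Λ₅⁽ᵏ⁾ᶜ), Ã^ε)φ_k⟩» FOR GENERAL `Ã` ON THE CONCRETE (Higgs)₂,₃ CARRIER** — the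
Neumann-decoupled form of file `B2Ineq327ConcreteNeumann` SPLITS over the pieces `Λ₅⁽⁰⁾ᶜ, B¹(Λ₁), …, Bᴷ(Λ_K)` into the `k = 0`
term `⟨φ₀, (−Δ^{ε,N}_{Ã,Λ₅⁽⁰⁾ᶜ} + m²)φ₀⟩` and, for each `k ≥ 1`, the quadratic form that the `k`-th order renormalization
transformation of the Neumann Gaussian on `Bᵏ(Λ_k)` carries in its exponent ((I.2.19), PROVED here on the piece) — and the
printed reduction of Proposition 3.1 (3.26) to the per-scale inequality (3.29), INSTANTIATED on this carrier

statement-level skeleton of published theorems with citation tags; proofs where landed; nothing here is a claim about the Yang–Mills mass gap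

CITATION HEADER.  T. Bałaban, *(Higgs)₂,₃ quantum fields in a finite volume. II. An upper bound*, Commun. Math. Phys. **86**
(1982) 555–594 [Balaban1982Higgs2] (cell paper B2; PDF held `paper:balaban1982-cmp86-higgs23-ii`, journal page = PDF page
+ 554; pp. 589–590 READ AS IMAGES on the ×2 renders
`run/shared/lean/pub/pub-balaban/b2b-balaban-ref1/pages/1982-cmp86-higgs23-II/1982-cmp86-higgs23-II-p035-x2.png`, `-p036-x2.png`);
part I [Balaban1982Higgs1], Commun. Math. Phys. **85** (1982) 603–626, (2.17)/(2.19) p. 610.  Unit `lit-balaban-p15` gen 4,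
target 2, file 2/2 (Phase-2 proof seat p15; HOME `run/shared/lean/pub/lit-balaban/`).  SKELETON rows **B2.Eq3.29** (members
(3.27)–(3.28); fold owner r02, second readers r14/r13, referee ref-4) and **B2.Prop3.1** (the reduction (3.26) ⇐ (3.27) +
(3.28) + (3.29) is b2b's `B2.prop31_of_decoupling`, used BY NAME).  r14 g5's `B2Prop31ZeroFieldModel` (p252013) proves
(3.27)₀/(3.28)₀ for a zero-field model on the b04 carriers; here: general `Ã`, the typer's torus carrier, and the objects
(3.23)/(3.24)/(3.25) of `B2Eq337ScalarIntegration`/`B2Eq325ConcreteSchur`/`B2Ineq327ConcreteNeumann`.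

WHAT IS PRINTED (verbatim, p. 589): *"Thus we have separated the expressions in the corresponding sets by Neumann boundary
conditions. … The form ⟨Φ, Δ′(Ã^ε)Φ⟩ is given by the formula
⟨Φ, Δ′(Ã^ε)Φ⟩ = Σ_{k=0}^{K} ⟨φ_k, Δ^{(k),Lᵏε}(Bᵏ(Λ₅⁽ᵏ⁻¹⁾′∩Λ₅⁽ᵏ⁾ᶜ), Ã^ε)φ_k⟩. (3.28)"*; p. 590: *"The term for k = 0 already
has the form required by the right side of (3.26), so we need the inequalities for the remaining terms. … Now inequality
(3.26) of the proposition follows from [(3.29)]"*; part I p. 610: *"Δ^{(0),ε}(Ω,A) = −Δ^{ε,N}_{A,Ω} + m², (2.17)"* and *"Z^ε_k(Ω,A)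
exp(−½⟨ψ,Δ^{(k),Lᵏε}(Ω,A)ψ⟩) = T^ε_{a_k,Lᵏ,A}[Ω, exp(−½⟨φ,(−Δ^{ε,N}_{A,Ω}+m²)φ⟩)] (2.19)"*.

DICTIONARY (print ↦ Lean).
 * the nested geometry of (2.5)–(2.8)/(3.22): `Λ₅⁽⁰⁾ = ⨆_{k=1}^{K} Bᵏ(Λ_k)` (disjoint union of the blocks of the regions
   `Λ_k = Λ₅⁽ᵏ⁻¹⁾′∩Λ₅⁽ᵏ⁾ᶜ`) ↦ the HYPOTHESIS `Nested R` on the region data `R : Regions P K` of (3.23)/(3.24) (`cover`: a site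
   of `T_ε` lies in `Λ₅⁽⁰⁾` iff it lies in some `Bᵏ(Λ_k)`; `uniq`: in at most one); `Bᵏ(Λ_k)` ↦ `pieceF R j` (`k = j + 1`; the
   tree's iterated block map `HiggsAveraging.blockIter`), `Λ₅⁽⁰⁾ᶜ` ↦ `outF R`; the sets separated by Neumann b.c. ↦
   `Nested.pieces : B2Ineq327ConcreteNeumann.Pieces P (Option (Fin K))`;
 * `⟨φ_k, Δ^{(k),Lᵏε}(Bᵏ(Λ_k), Ã^ε)φ_k⟩` (k ≥ 1) ↦ `termForm R C a A msq j ψ` := the fibre minimum of the exponent `pieceExp` of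
   `T^ε_{a_k,Lᵏ,Ã}[Bᵏ(Λ_k), exp(−½⟨φ,(−Δ^{ε,N}_{Ã,Bᵏ(Λ_k)}+m²)φ⟩)]` — BY (I.2.19), which is PROVED on the piece as `eq219_piece`:
   `pieceRT j ψ = pieceZ j · exp(−½·termForm j ψ)` (so `termForm` IS the printed ⟨ψ, Δ^{(k),Lᵏε}(Ω,Ã)ψ⟩ of (I.2.19) for
   `Ω = Bᵏ(Λ_k)`); the `k = 0` term ↦ `outTerm` = `⟨φ₀, (−Δ^{ε,N}_{Ã,Λ₅⁽⁰⁾ᶜ} + m²)φ₀⟩` ((I.2.17)) = `bond0 + mass0`.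

WHAT THIS MODULE PROVES (kernel-checked, 0 `sorry`, standard axioms; every `Ã`, `m² > 0`, `a > 0`, `L > 1`, any `R` with
`Nested R`).
 §0 `iInf_pi_sum` (infimum over independent variables of a sum = sum of infima), locality of the Neumann forms and of `Q_k(Ã)`
    (`siteInner_covLaplacianN_congr`, `avgQk_congr`).
 §1 geometry: `inPiece`/`pieceF`/`outF`, `Nested`, `Nested.pieces`, `Nested.inEquiv : Λ₅⁽⁰⁾ ≃ Σ_j Bʲ⁺¹(Λ_{j+1})`, `cfgEquiv`.
 §2 `extP` (extension by zero off a piece), `pieceExp`, `termForm`, `outTerm`, and **`jointFormN_split`**: the decoupled joint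
    exponent form = `outTerm` + Σ_j `pieceExp j` of the restricted variables (kernel terms by `avgQk_congr` — the block `Bᵏ(x_k)`
    of a site of `Λ_k` lies in `Bᵏ(Λ_k)`; Laplacian terms by locality; mass term by the partition).
 §3 **(3.28) `eq328_concrete`**: `form325N R C a (Nested.pieces) Ã m² Φ = outTerm Φ.1 + Σ_j termForm j (φ_{j+1}↾_{Λ_{j+1}})`
    (`Equiv.iInf_congr` along `cfgEquiv`, `add_ciInf`, `iInf_pi_sum`).
 §4 (I.2.19) on the piece: `pieceForm` (bilinear), `pieceForm_fibre_pos`, `termForm_eq_fibreForm`, **`eq219_piece`**.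
 §5 the k = 0 term *"already has the form required"*: `outTerm_eq` (= `bond0 + mass0`, `bond0_eq_sum` = Σ_{b⊂Λ₅⁽⁰⁾ᶜ}
    ε^d|(D_Ãφ₀)(b)|², `mass0_eq_sum` = Σ ε^d m²|φ₀(x)|²), and **`prop31_concrete`**: Proposition 3.1 (3.26) for
    `B2Eq325ConcreteSchur.form325` (= ⟨Φ, Δ(Ã^ε)Φ⟩, general `Ã`) from the per-scale inequalities (3.29) as hypotheses on the
    `termForm j` — `B2.prop31_of_decoupling` fed with `ineq327_concrete` (3.27), `eq328_concrete` (3.28) and the k = 0 term.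
HONEST SCOPE.  (i) `Nested R` is assumed, not derived from (2.5)–(2.8) (the tree's `Regions` are arbitrary finite sets);
(ii) the identification of `termForm` with the SOLVED formula (I.2.21) (`B1Eq230FluctCov.deltaKA`) is not done here — (I.2.19),
which defines `Δ^{(k)}(Ω,Ã)` in print, is; (iii) (3.29) enters `prop31_concrete` as a hypothesis (its zero-field case is r14's
`B2Prop31ZeroField.formZ_ge` on the b04 carrier; the restricted-field case is B4's Prop. 3.1′, cell GAPS G-pv07-1); the bond
and mass functionals of the k ≥ 1 terms of (3.26) are the abstract arguments `bond`, `mass` of that hypothesis.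
-/

noncomputable section

open MeasureTheory Finset Real
open scoped BigOperators ENNReal InnerProductSpace

namespace Literature.MathematicalPhysics.QuantumFieldTheory.Balaban1983to89.B2Eq328ConcretePieces

open Literature.MathematicalPhysics.QuantumFieldTheory.Balaban1983to89.HiggsLattice
open Literature.MathematicalPhysics.QuantumFieldTheory.Balaban1983to89.HiggsAveraging
open Literature.MathematicalPhysics.QuantumFieldTheory.Balaban1983to89.HiggsCovariance
open Literature.MathematicalPhysics.QuantumFieldTheory.Balaban1983to89.HiggsCovariancePos
open Literature.MathematicalPhysics.QuantumFieldTheory.Balaban1983to89.B2Ineq338Diamagnetic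
open Literature.MathematicalPhysics.QuantumFieldTheory.Balaban1983to89.B2Eq337ScalarIntegration
open Literature.MathematicalPhysics.QuantumFieldTheory.Balaban1983to89.B2Eq325ConcreteSchur
open Literature.MathematicalPhysics.QuantumFieldTheory.Balaban1983to89.B2Ineq327ConcreteNeumann

variable {P : HiggsLattice.Params} {N K : ℕ}

/-! ## §0 Generic: infimum over independent variables; locality of the Neumann form and of `Q_k(Ã)` -/

/-- The infimum over a product of a sum of functions of the separate factors is the sum of the infima (each bounded
below). [folklore] [cite: Balaban1982Higgs2, (3.28) p.589] -/
theorem iInf_pi_sum {J : Type*} [Fintype J] {X : J → Type*} [∀ j, Nonempty (X j)]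
    (g : (j : J) → X j → ℝ) (hg : ∀ j, BddBelow (Set.range (g j))) :
    (⨅ w : (j : J) → X j, ∑ j, g j (w j)) = ∑ j, ⨅ x : X j, g j x := by
  have hbdd : BddBelow (Set.range fun w : (j : J) → X j => ∑ j, g j (w j)) := by
    refine ⟨∑ j, ⨅ x : X j, g j x, ?_⟩
    rintro _ ⟨w, rfl⟩
    exact Finset.sum_le_sum fun j _ => ciInf_le (hg j) (w j)
  refine le_antisymm (le_of_forall_pos_le_add fun ε hε => ?_)
    (le_ciInf fun w => Finset.sum_le_sum fun j _ => ciInf_le (hg j) (w j))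
  set c : ℝ := (Fintype.card J : ℝ) with hc
  have hδ : 0 < ε / (c + 1) := by positivity
  have hx : ∀ j, ∃ x : X j, g j x < (⨅ y, g j y) + ε / (c + 1) := fun j =>
    exists_lt_of_ciInf_lt (lt_add_of_pos_right _ hδ)
  choose x hx using hx
  have hcε : c * (ε / (c + 1)) ≤ ε := by
    have h1 : c / (c + 1) ≤ 1 := div_le_one_of_le₀ (by linarith) (by positivity)
    calc c * (ε / (c + 1)) = ε * (c / (c + 1)) := by ring
      _ ≤ ε * 1 := mul_le_mul_of_nonneg_left h1 hε.le
      _ = ε := mul_one ε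
  calc (⨅ w : (j : J) → X j, ∑ j, g j (w j)) ≤ ∑ j, g j (x j) := ciInf_le hbdd x
    _ ≤ ∑ j, ((⨅ y, g j y) + ε / (c + 1)) := Finset.sum_le_sum fun j _ => (hx j).le
    _ = (∑ j, ⨅ y, g j y) + c * (ε / (c + 1)) := by
        rw [Finset.sum_add_distrib, Finset.sum_const, nsmul_eq_mul, Finset.card_univ]
    _ ≤ (∑ j, ⨅ y, g j y) + ε := by linarith

/-- The Neumann form on `Ω` sees only the values of the fields on `Ω`. [cite: Balaban1982Higgs1, (2.17) p.610] -/
theorem siteInner_covLaplacianN_congr (C : ChargeData N) (Ω : Finset (HiggsLattice.Site P 0))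
    (A : HiggsLattice.VecField P 0) {f g : ScalarField P 0 N} (h : ∀ x ∈ Ω, f x = g x) :
    siteInner f (covLaplacianN C Ω A f) = siteInner g (covLaplacianN C Ω A g) := by
  rw [siteInner_covLaplacianN, siteInner_covLaplacianN]
  refine Finset.sum_congr rfl fun b _ => ?_
  split_ifs with hb
  · simp only [HiggsLattice.covDeriv, h _ hb.1, h _ hb.2]
  · rfl

/-- `(Q_k(Ã)f)(y)` sees only the values of `f` on the block `Bᵏ(y)`. [cite: Balaban1982Higgs1, (2.11) p.609] -/
theorem avgQk_congr (C : ChargeData N) (A : HiggsLattice.VecField P 0) (k : ℕ) {f g : ScalarField P 0 N}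
    (y : HiggsLattice.Site P k) (h : ∀ x ∈ blockK k y, f x = g x) :
    avgQk C A k f y = avgQk C A k g y := by
  rw [avgQk_apply, avgQk_apply]
  exact congrArg _ (Finset.sum_congr rfl fun x hx => by rw [h x hx])

/-- `⟨f, f⟩ = Σ_x ε^d|f(x)|²` split along a decidable predicate on the sites. [folklore] [cite: Balaban1982Higgs2, (3.24) p.588] -/
theorem siteInner_self_split (p : HiggsLattice.Site P 0 → Prop) [DecidablePred p] (f : ScalarField P 0 N) :
    siteInner f f = (∑ x : {x // p x}, P.mesh 0 ^ P.d * ‖f x.val‖ ^ 2)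
      + ∑ x : {x // ¬ p x}, P.mesh 0 ^ P.d * ‖f x.val‖ ^ 2 := by
  rw [siteInner_self_eq, ← Fintype.sum_subtype_add_sum_subtype p (fun x => P.mesh 0 ^ P.d * ‖f x‖ ^ 2)]

/-! ## §1 The nested geometry: `Λ₅⁽⁰⁾ = ⨆_k Bᵏ(Λ_k)` -/

section Geometry

variable (R : Regions P K)

/-- `x ∈ Bʲ⁺¹(Λ_{j+1})`: the `(j+1)`-block point of the site `x ∈ T_ε` lies in `Λ_{j+1}`. [cite: Balaban1982Higgs2, (3.28) p.589] -/
def inPiece (j : Fin K) (x : HiggsLattice.Site P 0) : Prop := blockIter (j.val + 1) x ∈ R.block j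

/-- Decidability of `inPiece`. [folklore] [cite: Balaban1982Higgs2, (3.28) p.589] -/
instance instDecidablePredInPiece (j : Fin K) : DecidablePred (inPiece R j) := fun x =>
  inferInstanceAs (Decidable (blockIter (j.val + 1) x ∈ R.block j))

/-- `Bʲ⁺¹(Λ_{j+1}) ⊂ T_ε` as a finite set. [cite: Balaban1982Higgs2, (3.28) p.589] -/
def pieceF (j : Fin K) : Finset (HiggsLattice.Site P 0) := univ.filter (inPiece R j)

/-- Membership in `pieceF`. [cite: Balaban1982Higgs2, (3.28) p.589] -/
@[simp] theorem mem_pieceF (j : Fin K) (x : HiggsLattice.Site P 0) : x ∈ pieceF R j ↔ inPiece R j x := by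
  simp [pieceF]

/-- `Λ₅⁽⁰⁾ᶜ ⊂ T_ε` as a finite set (the `k = 0` region of (3.26)/(3.28)). [cite: Balaban1982Higgs2, (3.28) p.589] -/
def outF : Finset (HiggsLattice.Site P 0) := univ.filter fun x => ¬ R.isIn x

/-- Membership in `outF`. [cite: Balaban1982Higgs2, (3.28) p.589] -/
@[simp] theorem mem_outF (x : HiggsLattice.Site P 0) : x ∈ outF R ↔ ¬ R.isIn x := by
  simp [outF]

/-- **The nested geometry of (2.5)–(2.8)/(3.22)** as a hypothesis on the region data: `Λ₅⁽⁰⁾` is the DISJOINT UNION of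
the iterated blocks `Bᵏ(Λ_k)`, `k = 1, …, K` (`Λ_k = Λ₅⁽ᵏ⁻¹⁾′ ∩ Λ₅⁽ᵏ⁾ᶜ`). [cite: Balaban1982Higgs2, (3.24) p.588, (3.28) p.589] -/
structure Nested : Prop where
  /-- every site of `Λ₅⁽⁰⁾` lies in some `Bᵏ(Λ_k)`, and these lie in `Λ₅⁽⁰⁾` -/
  cover : ∀ x, R.isIn x ↔ ∃ j, inPiece R j x
  /-- … in at most one -/
  uniq : ∀ x (j j' : Fin K), inPiece R j x → inPiece R j' x → j = j'

variable {R}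

/-- The sets separated by Neumann boundary conditions: `Λ₅⁽⁰⁾ᶜ` (index `none`) and `Bʲ⁺¹(Λ_{j+1})` (index `some j`) — pairwise
disjoint under `Nested`. [cite: Balaban1982Higgs2, (3.27)–(3.28) p.589] -/
def Nested.pieces (hR : Nested R) : Pieces P (Option (Fin K)) where
  piece o := o.elim (outF R) (pieceF R)
  disj := by
    intro o o' hne
    rcases o with _ | j <;> rcases o' with _ | j'
    · exact absurd rfl hne
    · exact Finset.disjoint_left.mpr fun x hx hx' =>
        (by simpa using hx : ¬ R.isIn x) ((hR.cover x).mpr ⟨j', by simpa using hx'⟩)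
    · exact Finset.disjoint_left.mpr fun x hx hx' =>
        (by simpa using hx' : ¬ R.isIn x) ((hR.cover x).mpr ⟨j, by simpa using hx⟩)
    · exact Finset.disjoint_left.mpr fun x hx hx' =>
        hne (congrArg some (hR.uniq x j j' (by simpa using hx) (by simpa using hx')))

/-- Unfolding: the `none` piece is `Λ₅⁽⁰⁾ᶜ`. [cite: Balaban1982Higgs2, (3.28) p.589] -/
@[simp] theorem Nested.piece_none (hR : Nested R) : hR.pieces.piece none = outF R := rfl

/-- Unfolding: the `some j` piece is `Bʲ⁺¹(Λ_{j+1})`. [cite: Balaban1982Higgs2, (3.28) p.589] -/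
@[simp] theorem Nested.piece_some (hR : Nested R) (j : Fin K) : hR.pieces.piece (some j) = pieceF R j := rfl

variable (R)

/-- The sites of `Bʲ⁺¹(Λ_{j+1})`. [cite: Balaban1982Higgs2, (3.28) p.589] -/
abbrev PSite (j : Fin K) : Type := {x : HiggsLattice.Site P 0 // inPiece R j x}

/-- The sites of `Λ_{j+1}`. [cite: Balaban1982Higgs2, (3.24) p.588] -/
abbrev LSite (j : Fin K) : Type := {y : HiggsLattice.Site P (j.val + 1) // y ∈ R.block j}

variable {R}

/-- The piece index of a site of `Λ₅⁽⁰⁾`. [cite: Balaban1982Higgs2, (3.28) p.589] -/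
def Nested.idx (hR : Nested R) (i : R.InSite) : Fin K := Classical.choose ((hR.cover i.val).mp i.prop)

/-- The site lies in the piece of its index. [cite: Balaban1982Higgs2, (3.28) p.589] -/
theorem Nested.idx_spec (hR : Nested R) (i : R.InSite) : inPiece R (hR.idx i) i.val :=
  Classical.choose_spec ((hR.cover i.val).mp i.prop)

/-- Uniqueness of the piece index. [cite: Balaban1982Higgs2, (3.28) p.589] -/
theorem Nested.idx_eq (hR : Nested R) {i : R.InSite} {j : Fin K} (h : inPiece R j i.val) : hR.idx i = j :=
  hR.uniq _ _ _ (hR.idx_spec i) h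

/-- **`Λ₅⁽⁰⁾ ≃ Σ_j Bʲ⁺¹(Λ_{j+1})`** (the disjoint-union decomposition). [cite: Balaban1982Higgs2, (3.28) p.589] -/
def Nested.inEquiv (hR : Nested R) : R.InSite ≃ Σ j : Fin K, PSite R j where
  toFun i := ⟨hR.idx i, ⟨i.val, hR.idx_spec i⟩⟩
  invFun p := ⟨p.2.val, (hR.cover p.2.val).mpr ⟨p.1, p.2.prop⟩⟩
  left_inv i := rfl
  right_inv p := by
    obtain ⟨j, x⟩ := p
    exact Sigma.subtype_ext (hR.idx_eq (i := ⟨x.val, (hR.cover x.val).mpr ⟨j, x.prop⟩⟩) x.prop) rfl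

/-- The fibre variable `φ₀↾_{Λ₅⁽⁰⁾}` as the tuple of its restrictions to the pieces. [cite: Balaban1982Higgs2, (3.28) p.589] -/
def cfgEquiv (hR : Nested R) : InCfg R N ≃ ((j : Fin K) → (PSite R j → V N)) :=
  (Equiv.arrowCongr hR.inEquiv (Equiv.refl (V N))).trans (Equiv.piCurry fun _ _ => V N)

/-- Restriction of the fibre variable to the piece `Bʲ⁺¹(Λ_{j+1}) ⊂ Λ₅⁽⁰⁾`. [cite: Balaban1982Higgs2, (3.28) p.589] -/
def resP (hR : Nested R) (j : Fin K) (u : InCfg R N) : PSite R j → V N :=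
  fun x => u ⟨x.val, (hR.cover x.val).mpr ⟨j, x.prop⟩⟩

/-- The components of `cfgEquiv` are the restrictions. [cite: Balaban1982Higgs2, (3.28) p.589] -/
theorem cfgEquiv_apply (hR : Nested R) (u : InCfg R N) (j : Fin K) : cfgEquiv hR u j = resP hR j u := by
  funext x
  simp [cfgEquiv, resP, Equiv.arrowCongr_apply, Equiv.piCurry, Sigma.curry, Nested.inEquiv]

variable (R)

/-- `φ_{j+1}↾_{Λ_{j+1}}`: the level-`(j+1)` part of the configuration `Φ`. [cite: Balaban1982Higgs2, (3.24) p.588] -/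
def resL (j : Fin K) (Φ : Cfg R N) : LSite R j → V N := fun y => Φ.2 ⟨j, y⟩

/-- Extension by zero off the piece `Bʲ⁺¹(Λ_{j+1})` (the paper's `φ↾_Ω` as a field on `T_ε`). [cite: Balaban1982Higgs1, (2.17) p.610] -/
def extP (j : Fin K) (v : PSite R j → V N) : ScalarField P 0 N :=
  fun x => if h : inPiece R j x then v ⟨x, h⟩ else 0

/-- `extP` on the piece. [cite: Balaban1982Higgs1, (2.17) p.610] -/
theorem extP_apply_of (j : Fin K) (v : PSite R j → V N) {x : HiggsLattice.Site P 0} (h : inPiece R j x) :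
    extP R j v x = v ⟨x, h⟩ := by
  simp [extP, h]

/-- `extP` off the piece. [cite: Balaban1982Higgs1, (2.17) p.610] -/
theorem extP_apply_of_not (j : Fin K) (v : PSite R j → V N) {x : HiggsLattice.Site P 0} (h : ¬ inPiece R j x) :
    extP R j v x = 0 := by
  simp [extP, h]

/-- `⟨extP v, extP v⟩ = Σ_{x∈piece} ε^d|v(x)|²`. [cite: Balaban1982Higgs1, (2.17) p.610] -/
theorem siteInner_extP_self (j : Fin K) (v : PSite R j → V N) :
    siteInner (extP R j v) (extP R j v) = ∑ x : PSite R j, P.mesh 0 ^ P.d * ‖v x‖ ^ 2 := by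
  rw [siteInner_self_split (inPiece R j)]
  have h0 : ∑ x : {x // ¬ inPiece R j x}, P.mesh 0 ^ P.d * ‖extP R j v x.val‖ ^ 2 = 0 :=
    Finset.sum_eq_zero fun x _ => by rw [extP_apply_of_not R j v x.prop]; simp
  rw [h0, add_zero]
  exact Finset.sum_congr rfl fun x _ => by rw [extP_apply_of R j v x.prop]

end Geometry

/-! ## §2 The per-piece exponent ((I.2.19) on `Ω = Bᵏ(Λ_k)`), the k = 0 term, and the pointwise splitting -/

section Split

variable (R : Regions P K) (C : ChargeData N) (a : ℝ) (A : HiggsLattice.VecField P 0) (msq : ℝ)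

/-- **Twice (minus) the exponent of (I.2.19) on `Ω = Bʲ⁺¹(Λ_{j+1})`**:
`a_k(Lᵏε)^{d−2} Σ_{y∈Λ_k}|ψ(y) − (Q_k(Ã)φ)(y)|² + ⟨φ, (−Δ^{ε,N}_{Ã,Ω} + m²)φ⟩` for `φ` supported on `Ω` (`k = j + 1`).
[cite: Balaban1982Higgs1, (2.19) p.610] [cite: Balaban1982Higgs2, (3.28) p.589] -/
def pieceExp (j : Fin K) (ψ : LSite R j → V N) (v : PSite R j → V N) : ℝ :=
  (∑ y : LSite R j, precAt P a (j.val + 1) * ‖ψ y - avgQk C A (j.val + 1) (extP R j v) y.val‖ ^ 2)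
    + siteInner (extP R j v) (delta0 C (pieceF R j) A msq (extP R j v))

/-- **`⟨φ_k, Δ^{(k),Lᵏε}(Bᵏ(Λ_k), Ã^ε)φ_k⟩`** (k = j + 1): the fibre minimum of the (I.2.19) exponent on the piece — the
quadratic form left in the exponent by the k-th order renormalization transformation of the Neumann Gaussian on `Bᵏ(Λ_k)`
(`eq219_piece`). [cite: Balaban1982Higgs1, (2.19) p.610] [cite: Balaban1982Higgs2, (3.28) p.589] -/
def termForm (j : Fin K) (ψ : LSite R j → V N) : ℝ := ⨅ v : PSite R j → V N, pieceExp R C a A msq j ψ v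

/-- **The `k = 0` term of (3.28)**: `⟨φ₀, Δ^{(0),ε}(Λ₅⁽⁰⁾ᶜ, Ã^ε)φ₀⟩ = ⟨φ₀, (−Δ^{ε,N}_{Ã,Λ₅⁽⁰⁾ᶜ} + m²)φ₀⟩` ((I.2.17)), `φ₀` the
`Λ₅⁽⁰⁾ᶜ`-part of `Φ` extended by zero. [cite: Balaban1982Higgs1, (2.17) p.610] [cite: Balaban1982Higgs2, (3.28) p.589] -/
def outTerm (φout : R.OutSite → V N) : ℝ :=
  siteInner (field R φout (0 : InCfg R N)) (delta0 C (outF R) A msq (field R φout (0 : InCfg R N)))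

variable {a msq}

/-- The per-piece exponent is non-negative (`m² ≥ 0`). [cite: Balaban1982Higgs1, (2.19) p.610] -/
theorem pieceExp_nonneg (ha : 0 < a) (hL : 1 < P.L) (hmsq : 0 ≤ msq) (j : Fin K) (ψ : LSite R j → V N)
    (v : PSite R j → V N) : 0 ≤ pieceExp R C a A msq j ψ v :=
  add_nonneg (Finset.sum_nonneg fun _ _ => mul_nonneg (precAt_pos ha hL (Nat.le_add_left 1 _)).le (sq_nonneg _))
    (le_trans (mul_nonneg hmsq (siteInner_self_nonneg _)) (siteInner_delta0_ge C A msq (pieceF R j) _))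

variable (a msq)

/-- **Pointwise splitting of the decoupled exponent** over the pieces: for the Neumann-decoupled operator along
`Λ₅⁽⁰⁾ᶜ, B¹(Λ₁), …, Bᴷ(Λ_K)`, the joint exponent form of (3.23)′ is the `k = 0` term plus the sum over `k ≥ 1` of the
(I.2.19) exponents of the restricted variables. [cite: Balaban1982Higgs2, (3.28) p.589] -/
theorem jointFormN_split (hR : Nested R) (Φ : Cfg R N) (u : InCfg R N) :
    jointFormN R C a hR.pieces A msq (Φ, u) (Φ, u)
      = outTerm R C A msq Φ.1 + ∑ j, pieceExp R C a A msq j (resL R j Φ) (resP hR j u) := by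
  have hd0 : ∀ (Ω : Finset (HiggsLattice.Site P 0)) (f : ScalarField P 0 N),
      siteInner f (delta0 C Ω A msq f) = siteInner f (covLaplacianN C Ω A f) + msq * siteInner f f := by
    intro Ω f
    rw [← siteBilin_apply, delta0_apply, map_add, map_smul, siteBilin_apply, siteBilin_apply, smul_eq_mul]
  rw [jointFormN_apply, siteInner_deltaN]
  dsimp only
  set φ : ScalarField P 0 N := field R Φ.1 u with hφ
  -- values of the glued field on the pieces and outside
  have hφ_in : ∀ (j : Fin K) (x : HiggsLattice.Site P 0) (hx : inPiece R j x),
      φ x = extP R j (resP hR j u) x := by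
    intro j x hx
    have hin : R.isIn x := (hR.cover x).mpr ⟨j, hx⟩
    rw [extP_apply_of R j _ hx, hφ]
    simp [field, hin, resP]
  have hφ_out : ∀ x : HiggsLattice.Site P 0, ¬ R.isIn x → φ x = field R Φ.1 (0 : InCfg R N) x := by
    intro x hx
    rw [hφ]
    simp [field, hx]
  -- (i) kernel terms: the block `Bᵏ(y)` of `y ∈ Λ_k` lies inside the piece `Bᵏ(Λ_k)`
  have hker : (∑ s : R.BlockSite, precAt P a (R.lvl s) * ⟪Φ.2 s - qMean C A R φ s, Φ.2 s - qMean C A R φ s⟫_ℝ)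
      = ∑ j, ∑ y : LSite R j, precAt P a (j.val + 1)
          * ‖resL R j Φ y - avgQk C A (j.val + 1) (extP R j (resP hR j u)) y.val‖ ^ 2 := by
    rw [Fintype.sum_sigma]
    refine Finset.sum_congr rfl fun j _ => Finset.sum_congr rfl fun y _ => ?_
    have hq : qMean C A R φ ⟨j, y⟩ = avgQk C A (j.val + 1) (extP R j (resP hR j u)) y.val := by
      rw [qMean_eq_avgQk]
      exact avgQk_congr C A (j.val + 1) y.val fun x hx => hφ_in j x (by
        rw [mem_blockK] at hx
        show blockIter (j.val + 1) x ∈ R.block j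
        rw [hx]
        exact y.prop)
    simp only [real_inner_self_eq_norm_sq, hq, resL]
  -- (ii) Laplacian terms: locality of the Neumann forms
  have hlap : (∑ o : Option (Fin K), siteInner φ (covLaplacianN C (hR.pieces.piece o) A φ))
      = siteInner (field R Φ.1 (0 : InCfg R N)) (covLaplacianN C (outF R) A (field R Φ.1 (0 : InCfg R N)))
        + ∑ j, siteInner (extP R j (resP hR j u)) (covLaplacianN C (pieceF R j) A (extP R j (resP hR j u))) := by
    rw [Fintype.sum_option, Nested.piece_none]
    congr 1
    · exact siteInner_covLaplacianN_congr C (outF R) A fun x hx => hφ_out x (by simpa using hx)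
    · refine Finset.sum_congr rfl fun j _ => ?_
      rw [Nested.piece_some]
      exact siteInner_covLaplacianN_congr C (pieceF R j) A fun x hx => hφ_in j x (by simpa using hx)
  -- (iii) mass terms: the partition `T_ε = Λ₅⁽⁰⁾ᶜ ⊔ ⨆_j Bʲ⁺¹(Λ_{j+1})`
  have hmass_out : siteInner (field R Φ.1 (0 : InCfg R N)) (field R Φ.1 (0 : InCfg R N))
      = ∑ o : R.OutSite, P.mesh 0 ^ P.d * ‖Φ.1 o‖ ^ 2 := by
    rw [siteInner_self_split R.isIn]
    have h0 : ∑ x : R.InSite, P.mesh 0 ^ P.d * ‖field R Φ.1 (0 : InCfg R N) x.val‖ ^ 2 = 0 :=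
      Finset.sum_eq_zero fun x _ => by rw [field_apply_in]; simp
    rw [h0, zero_add]
    exact Finset.sum_congr rfl fun o _ => by rw [field_apply_out]
  have hmass : siteInner φ φ = (∑ o : R.OutSite, P.mesh 0 ^ P.d * ‖Φ.1 o‖ ^ 2)
      + ∑ j, ∑ x : PSite R j, P.mesh 0 ^ P.d * ‖resP hR j u x‖ ^ 2 := by
    rw [siteInner_self_split R.isIn, add_comm]
    congr 1
    · exact Finset.sum_congr rfl fun o _ => by simp only [hφ, field_apply_out]
    · rw [Fintype.sum_equiv hR.inEquiv _ (fun p : Σ j : Fin K, PSite R j => P.mesh 0 ^ P.d * ‖resP hR p.1 u p.2‖ ^ 2)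
        (fun i => by simp only [hφ, field_apply_in, resP, Nested.inEquiv, Equiv.coe_fn_mk]), Fintype.sum_sigma]
  -- the right side, expanded
  have hrhs : outTerm R C A msq Φ.1 + ∑ j, pieceExp R C a A msq j (resL R j Φ) (resP hR j u)
      = (siteInner (field R Φ.1 (0 : InCfg R N)) (covLaplacianN C (outF R) A (field R Φ.1 (0 : InCfg R N)))
          + msq * ∑ o : R.OutSite, P.mesh 0 ^ P.d * ‖Φ.1 o‖ ^ 2)
        + ∑ j, ((∑ y : LSite R j, precAt P a (j.val + 1)
            * ‖resL R j Φ y - avgQk C A (j.val + 1) (extP R j (resP hR j u)) y.val‖ ^ 2)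
          + (siteInner (extP R j (resP hR j u)) (covLaplacianN C (pieceF R j) A (extP R j (resP hR j u)))
            + msq * ∑ x : PSite R j, P.mesh 0 ^ P.d * ‖resP hR j u x‖ ^ 2)) := by
    unfold outTerm pieceExp
    rw [hd0, hmass_out]
    congr 1
    exact Finset.sum_congr rfl fun j _ => by rw [hd0, siteInner_extP_self]
  have hM : ∑ j, msq * ∑ x : PSite R j, P.mesh 0 ^ P.d * ‖resP hR j u x‖ ^ 2
      = msq * ∑ j, ∑ x : PSite R j, P.mesh 0 ^ P.d * ‖resP hR j u x‖ ^ 2 := by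
    rw [Finset.mul_sum]
  rw [hker, hlap, hmass, hrhs, Finset.sum_add_distrib, Finset.sum_add_distrib, hM]
  ring

end Split

/-! ## §3 (3.28): the decoupled form SPLITS over the pieces -/

section Eq328

variable (R : Regions P K) (C : ChargeData N) {a : ℝ} (A : HiggsLattice.VecField P 0) {msq : ℝ}

/-- **(3.28) ON THE CONCRETE CARRIER, GENERAL `Ã`**: *"⟨Φ, Δ′(Ã^ε)Φ⟩ = Σ_{k=0}^{K} ⟨φ_k, Δ^{(k),Lᵏε}(Bᵏ(Λ₅⁽ᵏ⁻¹⁾′∩Λ₅⁽ᵏ⁾ᶜ),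
Ã^ε)φ_k⟩"* — the Neumann-decoupled form `form325N` (file `B2Ineq327ConcreteNeumann`, pieces `Λ₅⁽⁰⁾ᶜ, B¹(Λ₁), …, Bᴷ(Λ_K)`) is the
`k = 0` term plus the per-scale forms of the block variables. PROVED for every `Ã`, `m² ≥ 0`, `a > 0`, `L > 1`, under
`Nested R`. [cite: Balaban1982Higgs2, (3.28) p.589] -/
theorem eq328_concrete (hR : Nested R) (ha : 0 < a) (hL : 1 < P.L) (hmsq : 0 ≤ msq) (Φ : Cfg R N) :
    form325N R C a hR.pieces A msq Φ = outTerm R C A msq Φ.1 + ∑ j, termForm R C a A msq j (resL R j Φ) := by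
  unfold form325N termForm
  have h1 : (⨅ u : InCfg R N, jointFormN R C a hR.pieces A msq (Φ, u) (Φ, u))
      = ⨅ w : (j : Fin K) → (PSite R j → V N),
          (outTerm R C A msq Φ.1 + ∑ j, pieceExp R C a A msq j (resL R j Φ) (w j)) := by
    refine Equiv.iInf_congr (cfgEquiv hR) fun u => ?_
    rw [jointFormN_split R C a A msq hR Φ u]
    simp_rw [cfgEquiv_apply]
  have hbdd : BddBelow (Set.range fun w : (j : Fin K) → (PSite R j → V N) =>
      ∑ j, pieceExp R C a A msq j (resL R j Φ) (w j)) :=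
    ⟨0, by
      rintro _ ⟨w, rfl⟩
      exact Finset.sum_nonneg fun j _ => pieceExp_nonneg R C A ha hL hmsq j _ _⟩
  rw [h1, ← add_ciInf hbdd, iInf_pi_sum _ fun j => ⟨0, ?_⟩]
  rintro _ ⟨v, rfl⟩
  exact pieceExp_nonneg R C A ha hL hmsq j _ _

/-- (3.28) with the Schur-complement bilinear operator `delta325N` of file `B2Ineq327ConcreteNeumann` on the left.
[cite: Balaban1982Higgs2, (3.28) p.589] -/
theorem eq328_delta (hR : Nested R) (ha : 0 < a) (hL : 1 < P.L) (hmsq : 0 < msq) (Φ : Cfg R N) :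
    delta325N R C hR.pieces A ha hL hmsq Φ Φ = outTerm R C A msq Φ.1 + ∑ j, termForm R C a A msq j (resL R j Φ) := by
  rw [← form325N_eq_delta325N, eq328_concrete R C A hR ha hL hmsq.le]

end Eq328


/-! ## §4 (I.2.19) on the piece: the renormalization transformation of the Neumann Gaussian on `Bᵏ(Λ_k)` IS a Gaussian
with the form `termForm` in the exponent -/

section Eq219

variable (R : Regions P K) (C : ChargeData N) (a : ℝ) (A : HiggsLattice.VecField P 0) (msq : ℝ)

/-- Extension by zero as a linear map. [cite: Balaban1982Higgs1, (2.17) p.610] -/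
def extPLin (j : Fin K) : (PSite R j → V N) →ₗ[ℝ] ScalarField P 0 N where
  toFun := extP R j
  map_add' v w := by
    funext x
    by_cases h : inPiece R j x
    · simp [extP, h]
    · simp [extP, h]
  map_smul' t v := by
    funext x
    by_cases h : inPiece R j x
    · simp [extP, h]
    · simp [extP, h]

/-- Unfolding `extPLin`. [cite: Balaban1982Higgs1, (2.17) p.610] -/
@[simp] theorem extPLin_apply (j : Fin K) (v : PSite R j → V N) : extPLin (N := N) R j v = extP R j v := rfl

/-- The difference `ψ(y) − (Q_k(Ã)φ)(y)` at a site `y ∈ Λ_k` as a linear map of `(ψ, φ↾_Ω)`. [cite: Balaban1982Higgs1, (2.19) p.610] -/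
def pieceDiff (j : Fin K) (y : LSite R j) : ((LSite R j → V N) × (PSite R j → V N)) →ₗ[ℝ] V N :=
  ((LinearMap.proj y : (LSite R j → V N) →ₗ[ℝ] V N) ∘ₗ LinearMap.fst ℝ (LSite R j → V N) (PSite R j → V N))
    - ((LinearMap.proj y.val : ScalarField P (j.val + 1) N →ₗ[ℝ] V N) ∘ₗ avgQkLin C A (j.val + 1) ∘ₗ extPLin R j
        ∘ₗ LinearMap.snd ℝ (LSite R j → V N) (PSite R j → V N))

/-- Unfolding `pieceDiff`. [cite: Balaban1982Higgs1, (2.19) p.610] -/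
@[simp] theorem pieceDiff_apply (j : Fin K) (y : LSite R j) (z : (LSite R j → V N) × (PSite R j → V N)) :
    pieceDiff R C A j y z = z.1 y - avgQk C A (j.val + 1) (extP R j z.2) y.val := by
  simp [pieceDiff, avgQkLin_apply]

/-- The (I.2.19) exponent on the piece as a bilinear form in `(ψ, φ↾_Ω)`. [cite: Balaban1982Higgs1, (2.19) p.610] -/
def pieceForm (j : Fin K) : LinearMap.BilinForm ℝ ((LSite R j → V N) × (PSite R j → V N)) :=
  (∑ y : LSite R j, precAt P a (j.val + 1) • (innerₗ (V N)).compl₁₂ (pieceDiff R C A j y) (pieceDiff R C A j y))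
    + (siteBilin P 0 N).compl₁₂ (extPLin R j ∘ₗ LinearMap.snd ℝ (LSite R j → V N) (PSite R j → V N))
        (delta0 C (pieceF R j) A msq ∘ₗ extPLin R j ∘ₗ LinearMap.snd ℝ (LSite R j → V N) (PSite R j → V N))

/-- Unfolding the piece form. [cite: Balaban1982Higgs1, (2.19) p.610] -/
theorem pieceForm_apply (j : Fin K) (z z' : (LSite R j → V N) × (PSite R j → V N)) :
    pieceForm R C a A msq j z z'
      = (∑ y : LSite R j, precAt P a (j.val + 1)
          * ⟪z.1 y - avgQk C A (j.val + 1) (extP R j z.2) y.val, z'.1 y - avgQk C A (j.val + 1) (extP R j z'.2) y.val⟫_ℝ)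
        + siteInner (extP R j z.2) (delta0 C (pieceF R j) A msq (extP R j z'.2)) := by
  simp only [pieceForm, LinearMap.add_apply, LinearMap.sum_apply, LinearMap.smul_apply, LinearMap.compl₁₂_apply,
    innerₗ_apply_apply, pieceDiff_apply, siteBilin_apply, extPLin_apply, LinearMap.comp_apply, LinearMap.snd_apply,
    smul_eq_mul]

/-- On the diagonal the piece form is `pieceExp`. [cite: Balaban1982Higgs1, (2.19) p.610] -/
theorem pieceForm_self (j : Fin K) (ψ : LSite R j → V N) (v : PSite R j → V N) :
    pieceForm R C a A msq j (ψ, v) (ψ, v) = pieceExp R C a A msq j ψ v := by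
  rw [pieceForm_apply, pieceExp]
  simp only [real_inner_self_eq_norm_sq]

/-- The piece form is symmetric. [cite: Balaban1982Higgs1, (2.19) p.610] -/
theorem pieceForm_symm (j : Fin K) (z z' : (LSite R j → V N) × (PSite R j → V N)) :
    pieceForm R C a A msq j z z' = pieceForm R C a A msq j z' z := by
  rw [pieceForm_apply, pieceForm_apply, siteInner_delta0_comm]
  congr 1
  exact Finset.sum_congr rfl fun y _ => by rw [real_inner_comm]

variable {a msq}

/-- The fibre block of the piece form is positive definite (`m² > 0`): `≥ m²ε^d Σ_{x∈Ω}|v(x)|²`. [cite: Balaban1982Higgs1, (2.19) p.610] -/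
theorem pieceForm_fibre_pos (ha : 0 < a) (hL : 1 < P.L) (hmsq : 0 < msq) (j : Fin K) (v : PSite R j → V N)
    (hv : v ≠ 0) : 0 < pieceForm R C a A msq j ((0 : LSite R j → V N), v) ((0 : LSite R j → V N), v) := by
  rw [pieceForm_self]
  unfold pieceExp
  refine add_pos_of_nonneg_of_pos
    (Finset.sum_nonneg fun _ _ => mul_nonneg (precAt_pos ha hL (Nat.le_add_left 1 _)).le (sq_nonneg _)) ?_
  refine lt_of_lt_of_le (mul_pos hmsq ?_) (siteInner_delta0_ge C A msq (pieceF R j) _)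
  rw [siteInner_extP_self]
  obtain ⟨i, hi⟩ := Function.ne_iff.mp hv
  have hterm : 0 < P.mesh 0 ^ P.d * ‖v i‖ ^ 2 := mul_pos (pow_pos (P.mesh_pos 0) _) (by positivity)
  exact lt_of_lt_of_le hterm (Finset.single_le_sum (f := fun x : PSite R j => P.mesh 0 ^ P.d * ‖v x‖ ^ 2)
    (fun x _ => mul_nonneg (pow_nonneg (P.mesh_pos 0).le _) (sq_nonneg _)) (Finset.mem_univ i))

/-- `termForm` is the Schur complement (value at the fibre minimiser) of the piece form. [cite: Balaban1982Higgs1, (2.19) p.610] -/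
theorem termForm_eq_fibreForm (ha : 0 < a) (hL : 1 < P.L) (hmsq : 0 < msq) (j : Fin K) (ψ : LSite R j → V N) :
    termForm R C a A msq j ψ
      = Fibre.fibreForm (pieceForm R C a A msq j) (pieceForm_fibre_pos R C A ha hL hmsq j) ψ := by
  rw [← Fibre.iInf_eq_fibreForm _ (pieceForm_symm R C a A msq j) _ ψ, termForm]
  simp_rw [pieceForm_self]

variable (a msq)

/-- **`T^ε_{a_k,Lᵏ,Ã}[Ω, exp(−½⟨φ,(−Δ^{ε,N}_{Ã,Ω}+m²)φ⟩)](ψ)`** on `Ω = Bʲ⁺¹(Λ_{j+1})` (`k = j + 1`): the integral over `φ↾_Ω` of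
the product of the kernels (I.2.10) at the sites of `Λ_k = Ω^{(k)}` times the Neumann Gaussian — the right side of (I.2.19).
[cite: Balaban1982Higgs1, (2.19) p.610] -/
def pieceRT (j : Fin K) (ψ : LSite R j → V N) : ℝ :=
  ∫ v : PSite R j → V N,
    (∏ y : LSite R j, B1RT.rtKernel (precAt P a (j.val + 1)) (ψ y - avgQk C A (j.val + 1) (extP R j v) y.val))
      * Real.exp (-(1/2 : ℝ) * siteInner (extP R j v) (delta0 C (pieceF R j) A msq (extP R j v)))

/-- **`Z^ε_k(Ω, Ã)`** of (I.2.19) on the piece: the transformation at `ψ = 0`. [cite: Balaban1982Higgs1, (2.19) p.610] -/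
def pieceZ (j : Fin K) : ℝ := pieceRT R C a A msq j 0

/-- The (I.2.19) integrand is `(constants) × exp(−½·pieceForm)`. [cite: Balaban1982Higgs1, (2.10) p.609, (2.19) p.610] -/
theorem pieceRT_integrand_eq (j : Fin K) (ψ : LSite R j → V N) (v : PSite R j → V N) :
    (∏ y : LSite R j, B1RT.rtKernel (precAt P a (j.val + 1)) (ψ y - avgQk C A (j.val + 1) (extP R j v) y.val))
        * Real.exp (-(1/2 : ℝ) * siteInner (extP R j v) (delta0 C (pieceF R j) A msq (extP R j v)))
      = (∏ _y : LSite R j, (precAt P a (j.val + 1) / (2 * π)) ^ ((N : ℝ) / 2))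
        * Real.exp (-(1/2 : ℝ) * pieceForm R C a A msq j (ψ, v) (ψ, v)) := by
  rw [pieceForm_self, pieceExp]
  simp only [B1RT.rtKernel_eq, finrank_V]
  rw [Finset.prod_mul_distrib, ← Real.exp_sum, mul_assoc, ← Real.exp_add]
  congr 2
  rw [mul_add, Finset.mul_sum]
  exact congrArg₂ (· + ·) (Finset.sum_congr rfl fun y _ => by ring) rfl

/-- **(I.2.19) ON THE PIECE, PROVED**: *"Z^ε_k(Ω,Ã) exp(−½⟨ψ, Δ^{(k),Lᵏε}(Ω,Ã)ψ⟩) = T^ε_{a_k,Lᵏ,Ã}[Ω, exp(−½⟨φ,(−Δ^{ε,N}_{Ã,Ω}+m²)φ⟩)]"*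
for `Ω = Bᵏ(Λ_k)`, with `⟨ψ, Δ^{(k),Lᵏε}(Ω,Ã)ψ⟩ = termForm` — completing the square on the fibre `φ↾_Ω`
(`B2Eq325ConcreteSchur.Fibre.integral_eq`). Every `Ã`, `m² > 0`. [cite: Balaban1982Higgs1, (2.19) p.610] [cite: Balaban1982Higgs2, (3.28) p.589] -/
theorem eq219_piece (ha : 0 < a) (hL : 1 < P.L) (hmsq : 0 < msq) (j : Fin K) (ψ : LSite R j → V N) :
    pieceRT R C a A msq j ψ = pieceZ R C a A msq j * Real.exp (-(1/2 : ℝ) * termForm R C a A msq j ψ) := by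
  have key : ∀ χ : LSite R j → V N, pieceRT R C a A msq j χ
      = (∏ _y : LSite R j, (precAt P a (j.val + 1) / (2 * π)) ^ ((N : ℝ) / 2))
        * (Real.exp (-(1/2 : ℝ) * termForm R C a A msq j χ)
          * ∫ v : PSite R j → V N, Real.exp (-(1/2 : ℝ)
              * pieceForm R C a A msq j ((0 : LSite R j → V N), v) ((0 : LSite R j → V N), v))) := by
    intro χ
    unfold pieceRT
    simp_rw [pieceRT_integrand_eq]
    rw [integral_const_mul, Fibre.integral_eq volume (pieceForm R C a A msq j) (pieceForm_symm R C a A msq j)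
      (pieceForm_fibre_pos R C A ha hL hmsq j) χ, termForm_eq_fibreForm R C A ha hL hmsq]
  have h0 : termForm R C a A msq j 0 = 0 := by
    rw [termForm_eq_fibreForm R C A ha hL hmsq, ← zero_smul ℝ (0 : LSite R j → V N), Fibre.fibreForm_smul]
    simp
  rw [pieceZ, key ψ, key 0, h0, mul_zero, Real.exp_zero, one_mul]
  ring

end Eq219

/-! ## §5 The `k = 0` term *"already has the form required"*, and Proposition 3.1 reduced to (3.29) on this carrier -/

section Prop31

variable (R : Regions P K) (C : ChargeData N) (a : ℝ) (A : HiggsLattice.VecField P 0) (msq : ℝ)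

/-- The `k = 0` bond term of (3.26): `Σ_{⟨x,x′⟩⊂Λ₅⁽⁰⁾ᶜ} ε^{d−2}|U(Ã^ε(⟨x,x′⟩))φ₀(x′) − φ₀(x)|²` = `⟨φ₀, (−Δ^{ε,N}_{Ã,Λ₅⁽⁰⁾ᶜ})φ₀⟩`.
[cite: Balaban1982Higgs2, Prop. 3.1 (3.26) p.589] -/
def bond0 (φout : R.OutSite → V N) : ℝ :=
  siteInner (field R φout (0 : InCfg R N)) (covLaplacianN C (outF R) A (field R φout (0 : InCfg R N)))

/-- The `k = 0` mass term of (3.26): `Σ_{x∈Λ₅⁽⁰⁾ᶜ} ε^d m²|φ₀(x)|²`. [cite: Balaban1982Higgs2, Prop. 3.1 (3.26) p.589] -/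
def mass0 (φout : R.OutSite → V N) : ℝ :=
  msq * siteInner (field R φout (0 : InCfg R N)) (field R φout (0 : InCfg R N))

/-- The bond term written over the bonds inside `Λ₅⁽⁰⁾ᶜ`: `Σ_{b⊂Λ₅⁽⁰⁾ᶜ} ε^d|(D^ε_Ãφ₀)(b)|²` (`(D^ε_Ãφ)(b) = ε⁻¹(U(A_b)φ(b₊) − φ(b₋))`,
so each summand is the printed `ε^{d−2}|U(Ã^ε(⟨x,x′⟩))φ₀(x′) − φ₀(x)|²`). [cite: Balaban1982Higgs2, Prop. 3.1 (3.26) p.589] -/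
theorem bond0_eq_sum (φout : R.OutSite → V N) :
    bond0 R C A φout = ∑ b : HiggsLattice.PBond P 0, if Inside (outF R) b then
      P.mesh 0 ^ P.d * ‖HiggsLattice.covDeriv C A (field R φout (0 : InCfg R N)) b‖ ^ 2 else 0 := by
  rw [bond0, siteInner_covLaplacianN]
  exact Finset.sum_congr rfl fun b _ => by
    split_ifs
    · rw [real_inner_self_eq_norm_sq]
    · rfl

/-- The mass term written over the sites of `Λ₅⁽⁰⁾ᶜ`. [cite: Balaban1982Higgs2, Prop. 3.1 (3.26) p.589] -/
theorem mass0_eq_sum (φout : R.OutSite → V N) :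
    mass0 R msq φout = ∑ o : R.OutSite, P.mesh 0 ^ P.d * msq * ‖φout o‖ ^ 2 := by
  rw [mass0, siteInner_self_split R.isIn]
  have h0 : ∑ x : R.InSite, P.mesh 0 ^ P.d * ‖field R φout (0 : InCfg R N) x.val‖ ^ 2 = 0 :=
    Finset.sum_eq_zero fun x _ => by rw [field_apply_in]; simp
  rw [h0, zero_add, Finset.mul_sum]
  exact Finset.sum_congr rfl fun o _ => by rw [field_apply_out]; ring

/-- ***"The term for k = 0 already has the form required by the right side of (3.26)"***: `outTerm = bond0 + mass0`.
[cite: Balaban1982Higgs2, (3.28) p.590] -/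
theorem outTerm_eq (φout : R.OutSite → V N) :
    outTerm R C A msq φout = bond0 R C A φout + mass0 R msq φout := by
  rw [outTerm, bond0, mass0, ← siteBilin_apply, delta0_apply, map_add, map_smul, siteBilin_apply, siteBilin_apply,
    smul_eq_mul]

/-- `bond0 ≥ 0`. [cite: Balaban1982Higgs2, Prop. 3.1 (3.26) p.589] -/
theorem bond0_nonneg (φout : R.OutSite → V N) : 0 ≤ bond0 R C A φout :=
  siteInner_covLaplacianN_nonneg C (outF R) A _

variable {msq}

/-- `mass0 ≥ 0` (`m² ≥ 0`). [cite: Balaban1982Higgs2, Prop. 3.1 (3.26) p.589] -/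
theorem mass0_nonneg (hmsq : 0 ≤ msq) (φout : R.OutSite → V N) : 0 ≤ mass0 R msq φout :=
  mul_nonneg hmsq (siteInner_self_nonneg _)

variable (msq)

/-- ℕ-indexed families `k = 0, 1, …, K` from a `k = 0` value and a `Fin K`-family (the indexing of `B2.prop31_of_decoupling`).
[folklore] [cite: Balaban1982Higgs2, Prop. 3.1 (3.26) p.589] -/
def natExt (f0 : ℝ) (f : Fin K → ℝ) (k : ℕ) : ℝ :=
  if k = 0 then f0 else if h : k - 1 < K then f ⟨k - 1, h⟩ else 0

/-- `natExt f0 f 0 = f0`. [folklore] [cite: Balaban1982Higgs2, Prop. 3.1 (3.26) p.589] -/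
@[simp] theorem natExt_zero (f0 : ℝ) (f : Fin K → ℝ) : natExt f0 f 0 = f0 := by
  simp [natExt]

/-- `natExt f0 f (j+1) = f j`. [folklore] [cite: Balaban1982Higgs2, Prop. 3.1 (3.26) p.589] -/
theorem natExt_succ (f0 : ℝ) (f : Fin K → ℝ) (j : Fin K) : natExt f0 f (j.val + 1) = f j := by
  simp only [natExt, Nat.add_one_ne_zero, if_false, Nat.add_sub_cancel, dif_pos j.isLt]

/-- `Σ_{k=0}^{K} natExt = f0 + Σ_j f j`. [folklore] [cite: Balaban1982Higgs2, Prop. 3.1 (3.26) p.589] -/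
theorem sum_range_natExt (f0 : ℝ) (f : Fin K → ℝ) :
    ∑ k ∈ Finset.range (K + 1), natExt f0 f k = f0 + ∑ j : Fin K, f j := by
  rw [Finset.sum_range_succ', natExt_zero, add_comm]
  congr 1
  rw [Finset.sum_range]
  exact Finset.sum_congr rfl fun j _ => natExt_succ f0 f j

/-- `Σ_{k=1}^{K} natExt = Σ_j f j`. [folklore] [cite: Balaban1982Higgs2, Prop. 3.1 (3.26) p.589] -/
theorem sum_Icc_natExt (f0 : ℝ) (f : Fin K → ℝ) :
    ∑ k ∈ Finset.Icc 1 K, natExt f0 f k = ∑ j : Fin K, f j := by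
  have h : ∑ k ∈ Finset.range (K + 1), natExt f0 f k = natExt f0 f 0 + ∑ k ∈ Finset.Icc 1 K, natExt f0 f k := by
    rw [Finset.sum_range_eq_add_Ico _ (by omega : 0 < K + 1), Finset.Ico_add_one_right_eq_Icc]
  have h2 := sum_range_natExt f0 f
  rw [h, natExt_zero] at h2
  linarith

variable {a msq}

/-- **Proposition 3.1 (3.26) REDUCED TO (3.29) ON THE CONCRETE CARRIER, GENERAL `Ã`** — the printed reduction p. 589–590
instantiated: from (3.27) (`ineq327_concrete`), (3.28) (`eq328_concrete`), the `k = 0` term (`outTerm_eq`, any `γ₀ ≤ 1`), and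
the per-scale inequalities (3.29) for `k = 1, …, K` AS HYPOTHESES on the forms `⟨φ_k, Δ^{(k),Lᵏε}(Bᵏ(Λ_k), Ã^ε)φ_k⟩ = termForm`
(with whatever bond/mass functionals and `O((Lᵏε)^{κ₀})|Λ_k|` errors they carry), inequality (3.26) holds for
`⟨Φ, Δ(Ã^ε)Φ⟩ = B2Eq325ConcreteSchur.form325` — via b2b's `B2.prop31_of_decoupling`. [cite: Balaban1982Higgs2, Prop. 3.1 (3.26) p.589] -/
theorem prop31_concrete (hR : Nested R) (ha : 0 < a) (hL : 1 < P.L) (hmsq : 0 < msq) {γ₀ : ℝ}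
    (hγ₁ : γ₀ ≤ 1) (bond mass : (j : Fin K) → (LSite R j → V N) → ℝ) (err : Fin K → ℝ)
    (h329 : ∀ (j : Fin K) (ψ : LSite R j → V N), γ₀ * (bond j ψ + mass j ψ) - err j ≤ termForm R C a A msq j ψ)
    (Φ : Cfg R N) :
    γ₀ * (bond0 R C A Φ.1 + ∑ j, bond j (resL R j Φ)) + γ₀ * (mass0 R msq Φ.1 + ∑ j, mass j (resL R j Φ))
        - ∑ j, err j ≤ form325 R C a A msq Φ := by
  have h327 := ineq327_concrete R C hR.pieces A ha hL hmsq Φ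
  have h328 := eq328_concrete R C A hR ha hL hmsq.le Φ
  have h0 : γ₀ * bond0 R C A Φ.1 + γ₀ * mass0 R msq Φ.1 ≤ outTerm R C A msq Φ.1 := by
    rw [outTerm_eq]
    have hb := bond0_nonneg R C A Φ.1
    have hm := mass0_nonneg R hmsq.le Φ.1
    nlinarith
  have key := B2.prop31_of_decoupling K γ₀ (form325 R C a A msq Φ) (form325N R C a hR.pieces A msq Φ)
    (natExt (outTerm R C A msq Φ.1) fun j => termForm R C a A msq j (resL R j Φ))
    (natExt (bond0 R C A Φ.1) fun j => bond j (resL R j Φ))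
    (natExt (mass0 R msq Φ.1) fun j => mass j (resL R j Φ))
    (natExt 0 err) h327 (by rw [sum_range_natExt]; exact h328) (by simpa using h0) (fun k hk1 hkK => by
      obtain ⟨j, rfl⟩ : ∃ j, k = j + 1 := ⟨k - 1, by omega⟩
      have hj : j < K := by omega
      have e1 := natExt_succ (bond0 R C A Φ.1) (fun j => bond j (resL R j Φ)) ⟨j, hj⟩
      have e2 := natExt_succ (mass0 R msq Φ.1) (fun j => mass j (resL R j Φ)) ⟨j, hj⟩
      have e3 := natExt_succ (0 : ℝ) err ⟨j, hj⟩
      have e4 := natExt_succ (outTerm R C A msq Φ.1) (fun j => termForm R C a A msq j (resL R j Φ)) ⟨j, hj⟩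
      simp only [] at e1 e2 e3 e4
      rw [e1, e2, e3, e4]
      exact h329 ⟨j, hj⟩ _)
  rw [sum_range_natExt, sum_range_natExt, sum_Icc_natExt] at key
  exact key

end Prop31

end Literature.MathematicalPhysics.QuantumFieldTheory.Balaban1983to89.B2Eq328ConcretePieces
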